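import Summits.QuantumFields.BalabanUV.T4Continuum.Spine.NE1p.DressedPositionalCountFam
import Summits.QuantumFields.BalabanUV.T4Continuum.Spine.NE1p.DressedFamilyDoorWitness

/-!
# T⁴ programme, spine estimate NE1′ (node O3b/H2) — THE WEIGHTED ANCHORING LAYER FIRES, AND WHERE IT CANNOT: S49's anchored END
# `dressedBudget_of_familyLeaves_anchored` on a decided anchored tower with NON-constant (bounded) history weights, and the kernel fact that
# W56's `famTower` — which passes END-B-fam's cube-side count K-freely — admits NO K-free weighted anchoring multiplicity for ANY anchoring

Cell `pub-balaban`, sub-cell `t4`, BINDER-OWNERS row NE1′; crew `b2b-balaban-t4-ne1p-formalise-*`, row **W65 ∕ DAG N29zzzr** of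
`t4/formal/NE1p/LEAVES.md` (BOOKED by typer RULING R-T137, CLAIMS.log l.22015, on INTENT l.21868), unit `b2b-balaban-t4-ne1p-formalise-leaf-02`
(gen 15).  ADDITIVE — imports THIS LINEAGE's S49 `Spine/NE1p/DressedPositionalCountFam` (p237010: `bookingCountH_of_anchoring`,
`hcountHq_of_anchoring`, `dressedBudget_of_familyLeaves_anchored`, `weightedCount_of_anchoring`) and W56 `Spine/NE1p/DressedFamilyDoorWitness`
(p235353: `famBooking` ∕ `famH` ∕ `famRate` ∕ `famTower` ∕ `famH_unbounded` ∕ `hcountHq_fam`) ONLY; toy DATA defs + theorems; nothing restated.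

WHY THIS FILE.  S49 RELOCATES where door 2 of the NE1′ wall pays the history price: END-B-fam's two weighted counts (`BookingLeavesFam.hcountH`,
`hcountHq`) follow from ONE weighted multiplicity per anchoring block (`Σ_{b : j_b = j, x ∈ dom b} H b ≤ mH`).  This file decides the two sides
of that relocation:
* §1 (POSITIVE — the layer fires): `ancBooking K` ∕ `ancTrajectory K` ∕ `ancTower` — two families per cutoff, both born at scale `0`, with the
  NON-constant history weights `ancH false = 1`, `ancH true = 2`, rates `1∕8` ∕ `1∕4`, felt at every cube; the block-lattice anchoring
  `ancAnchoring K : T4FeltGeometry.Anchoring (ancBooking K) 1 2` (every birth's domain = the block `0` of `ℕ¹`, every cube's centre = `0`,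
  `felt_under` by `coarsen 2 n 0 = 0`); the weighted multiplicity `mH = 3` ATTAINED at the scale-`0` block (`weightedMult_anc`,
  `weightedMult_attained`); ONE `U = ancConstants` (`N₀ = 3 = mH`, `Λ = 2 = L^d`, `ρ₁ = 1∕4`, `τ = 1∕2`, `ρ′ = 1∕4`, `s̄⁰ = 1∕2`, `m = 1∕8`);
  `ancLeaves K : BookingLeavesFam ancConstants …` whose count fields `hS`∕`hcountH` ARE S49's `bookingCountH_of_anchoring` (component = the
  cube of the current scale, `v = 1`, housing by `feltAt = univ`) — FIRST applier; **`dressedBudget_ancTower`** = S49's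
  `dressedBudget_of_familyLeaves_anchored` ONCE BY NAME (FIRST applier): ROOT-B for every weight profile `0 ≤ w ≤ w̄` with `hcountHq` no
  longer displayed.
* §2 (NEGATIVE — where the layer CANNOT fire): on W56's `famTower` (heavy weight `3^K` felt at the top cube only) END-B-fam's cube-side count
  holds K-freely (`hcountHq_fam`, `N₀ = 2`, `Λ = 3`), but **`famBooking_no_kfree_weightedMult`**: there is NO `mH` such that at every
  cutoff SOME anchoring (any dimension `d`, any blocking factor `L`) has weighted multiplicity `≤ mH` — the heavy family is felt at the top
  cube, so `felt_under` puts a block `x` in its domain, and the scale-`0` multiplicity at `x` is `≥ 3^K` (`famH_unbounded`).  So S49's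
  relocation is STRICTLY LOSSY: a weighted anchoring multiplicity charges the history weight AT THE ANCHOR, K-freely only for K-bounded
  weights per block; W56's positional-room mechanism (weight `Λ^K` admissible `K` scales above the anchor) is NOT captured by it
  (`anchoringLayer_strictly_stronger`).

HONEST FRAMING.  Decided toys over the booking vocabulary + one kernel `¬∃` about W56's toy; [folklore] bookkeeping, 0 sorry, 0 citations, NO
`def … : Prop` (toy DATA defs are `Booking`∕`Trajectory`∕`DressedTower`∕`UniformConstants`∕`Anchoring`∕`BookingLeavesFam` terms and a weight
profile).  NOTHING of Bałaban's densities is modelled or asserted; the file does NOT say which door the cell takes for the history price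
(`t4/ideate/NE1p-WALL.md` §5 — the owner's ∕ the wall's) and pays no history price on Bałaban's densities; it LOCATES that door 2 «by weighted
anchoring multiplicity» is strictly narrower than door 2 «by weighted positional count»; discharges no wall item; wall v1.8 (T4-DAG v48) does
NOT move; R-t4r2-Q2 NOT met thereby.  Headline (c4): «S49's anchored END ⇐ its named binders is inhabited; its multiplicity binder fails on
W56's tower», NEVER «NE1′ proved»; NE1′ NOT PRINTED, NOT PROVED; 0 binders instantiated on Bałaban's densities; spine PROVED 0∕9 unchanged;
count 9 unchanged.  Rung (B)+1 on ONE finite four-torus — NOT infinite volume, NOT a mass gap, NOT OS on ℝ⁴, NOT Clay, NOT summit progress.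
HONEST DEPENDENCY: continuum YM on T⁴ ⇐ BetaPertH ∧ nine spine estimates (0/9 proved); BetaPertH ⇐ (D1) ∧ (D4) ∧ CAP+tail; G-an2-4 gates
asym, D1 and NE2/3/4.
-/

noncomputable section

namespace Summit.QuantumFields.BalabanUV.T4Continuum.NE1p.DressedFamilyAnchoringWitness

open Finset
open scoped BigOperators
open Literature.MathematicalPhysics.QuantumFieldTheory.Balaban1983to89
open Literature.MathematicalPhysics.QuantumFieldTheory.Balaban1983to89.T4TermFormat
open Literature.MathematicalPhysics.QuantumFieldTheory.Balaban1983to89.T4TermFormat.Booking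
open Literature.MathematicalPhysics.QuantumFieldTheory.Balaban1983to89.T4FeltGeometry
open Literature.MathematicalPhysics.QuantumFieldTheory.Balaban1983to89.T4TrajectoryComparison
open Summit.QuantumFields.BalabanUV.T4Continuum.NE1pFamilyBudget
open Summit.QuantumFields.BalabanUV.T4Continuum.NE1p.DressedRoot
open Summit.QuantumFields.BalabanUV.T4Continuum.NE1p.DressedPositionalCountFam
open Summit.QuantumFields.BalabanUV.T4Continuum.NE1p.DressedFamilyDoorWitness

/-! ## §1 POSITIVE: an anchored two-family tower with bounded non-constant weights — S49's anchored END fires -/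

/-- HISTORY WEIGHT PROFILE [decided toy DATA]: the spine (`false`) weighs `1`, the twin (`true`) weighs `2` — NON-constant, bounded. [folklore] -/
def ancH : Bool → ℝ := fun b => if b then 2 else 1

/-- Read-out: the spine weighs `1`. [folklore] -/
@[simp] theorem ancH_spine : ancH false = 1 := by simp [ancH]

/-- Read-out: the twin weighs `2`. [folklore] -/
@[simp] theorem ancH_twin : ancH true = 2 := by simp [ancH]

/-- The weights are positive. [folklore] -/
theorem ancH_pos (b : Bool) : 0 < ancH b := by unfold ancH; split_ifs <;> norm_num

/-- THE ANCHORED TWO-FAMILY BOOKING at cutoff `K` [decided toy DATA]: families `Bool`, both born at scale `0`, felt at EVERY cube (one cube per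
scale); booked size of `b` at scale `k` = `ancH b·(famRate b)^k·(1∕2)^K` (W56's family rates `1∕8`, `1∕4` BY NAME). [folklore] -/
def ancBooking (K : ℕ) : T4TermFormat.Booking where
  K := K
  Dom := Unit
  domScale := fun _ => 0
  treeLen := fun _ => 0
  treeLen_nonneg := fun _ => le_rfl
  balSize := fun _ => 0
  Birth := Bool
  births := Finset.univ
  mem_births := fun b => Finset.mem_univ b
  birthScale := fun _ => 0
  birth_le := fun _ => Nat.zero_le K
  loc := fun _ => ()
  loc_scale := fun _ => rfl
  Cube := Fin (K + 1)
  cubes := Finset.univ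
  mem_cubes := fun q => Finset.mem_univ q
  cubeScale := fun q => q.val
  cube_le := fun q => Nat.lt_succ_iff.mp q.isLt
  feltAt := fun _ => Finset.univ
  felt_birth_le := fun _ _ _ => Nat.zero_le _
  size := fun b k => ancH b * famRate b ^ k * (1 / 2 : ℝ) ^ K
  size_nonneg := fun b k => mul_nonneg (mul_nonneg (ancH_pos b).le (pow_nonneg (famRate_nonneg b) k)) (by positivity)
  pair := fun _ _ _ => 0

/-- THE ANCHORED TRAJECTORY [decided toy DATA]: one generation per family (the birth, size `ancH b·(1∕2)^K`). [folklore] -/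
def ancTrajectory (K : ℕ) : Trajectory (ancBooking K) where
  lin := fun b k' k => if k' = 0 then ancH b * famRate b ^ k * (1 / 2 : ℝ) ^ K else 0
  lin_nonneg := fun b k' k => by
    split_ifs
    · exact mul_nonneg (mul_nonneg (ancH_pos b).le (pow_nonneg (famRate_nonneg b) k)) (by positivity)
    · exact le_rfl
  gen := fun b k' => if k' = 0 then ancH b * (1 / 2 : ℝ) ^ K else 0
  gen_nonneg := fun b k' => by
    split_ifs
    · exact mul_nonneg (ancH_pos b).le (by positivity)
    · exact le_rfl
  size_le := fun b k _ _ => by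
    show ancH b * famRate b ^ k * (1 / 2 : ℝ) ^ K ≤
      ∑ k' ∈ Icc 0 k, (if k' = 0 then ancH b * famRate b ^ k * (1 / 2 : ℝ) ^ K else 0)
    rw [Finset.sum_ite_eq' (Icc 0 k) 0 (fun _ => ancH b * famRate b ^ k * (1 / 2 : ℝ) ^ K)]
    simp

/-- THE ANCHORED TOWER [decided toy DATA]. [folklore] -/
def ancTower : DressedTower Unit where
  B := fun _ K => ancBooking K
  K_eq := fun _ _ => rfl
  T := fun _ K => ancTrajectory K

/-- THE BLOCK-LATTICE ANCHORING [decided toy DATA]: dimension `1`, blocking factor `2`; every birth's domain is the block `0` of its scale,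
every cube's centre is the block `0`; `felt_under` holds because `coarsen 2 n 0 = 0`. [folklore] -/
def ancAnchoring (K : ℕ) : Anchoring (ancBooking K) 1 2 where
  dom := fun _ => {fun _ => 0}
  center := fun _ => fun _ => 0
  felt_under := fun q b _ => ⟨fun _ => 0, Finset.mem_singleton_self _, by funext i; simp [coarsen]⟩

/-- THE UNIFORM CONSTANTS [decided]: `C = 1`, `A₀ = 1`, `ρ₁ = 1∕4`, `τ = 1∕2`, `Λ = 2 = L^d`, `N₀ = 3 = mH`, `ρ′ = 1∕4` (`Λρ₁τ = 1∕4` exactly),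
`s̄⁰ = 1∕2`, `m = 1∕8` (`m·N₀A₀(1−ρ′)⁻¹ = 1∕2 = 1 − s̄⁰`, with equality). [folklore] -/
def ancConstants : UniformConstants where
  C := 1
  A₀ := 1
  ρ₁ := 1 / 4
  τ := 1 / 2
  Λ := 2
  N₀ := 3
  ρ' := 1 / 4
  sbar := 1 / 2
  m := 1 / 8
  hC := zero_le_one
  hA₀ := zero_le_one
  hρ₁ := by norm_num
  hτ0 := by norm_num
  hτ1 := by norm_num
  hΛ := by norm_num
  hN₀ := by norm_num
  hm := by norm_num
  hρ'1 := by norm_num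
  hprod := by norm_num
  hsmall := by norm_num

/-- **THE WEIGHTED ANCHORING MULTIPLICITY IS `≤ 3`** [decided]: at every scale `j` and block `x`, the births of scale `j` whose domains contain
`x` weigh at most `3` (the scale-`0` fibre at the block `0` is both families, `1 + 2`; every other fibre is empty). [folklore] -/
theorem weightedMult_anc (K : ℕ) : ∀ (j : ℕ) (x : Fin 1 → ℕ),
    ∑ b ∈ (ancBooking K).births.filter (fun b => (ancBooking K).birthScale b = j ∧ x ∈ (ancAnchoring K).dom b), ancH b ≤ 3 := by
  intro j x
  calc ∑ b ∈ (ancBooking K).births.filter (fun b => (ancBooking K).birthScale b = j ∧ x ∈ (ancAnchoring K).dom b), ancH b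
      ≤ ∑ b ∈ (ancBooking K).births, ancH b :=
        Finset.sum_le_sum_of_subset_of_nonneg (Finset.filter_subset _ _) fun b _ _ => (ancH_pos b).le
    _ = 3 := by
        show ∑ b ∈ (Finset.univ : Finset Bool), ancH b = 3
        rw [Fintype.sum_bool, ancH_twin, ancH_spine]; norm_num

/-- … and `3` is ATTAINED at the scale-`0` block `0` (the multiplicity binder is tight). [folklore] -/
theorem weightedMult_attained (K : ℕ) :
    ∑ b ∈ (ancBooking K).births.filter
      (fun b => (ancBooking K).birthScale b = 0 ∧ (fun _ : Fin 1 => (0 : ℕ)) ∈ (ancAnchoring K).dom b), ancH b = 3 := by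
  have h : (ancBooking K).births.filter
      (fun b => (ancBooking K).birthScale b = 0 ∧ (fun _ : Fin 1 => (0 : ℕ)) ∈ (ancAnchoring K).dom b) = (ancBooking K).births :=
    Finset.filter_true_of_mem fun b _ => ⟨rfl, Finset.mem_singleton_self _⟩
  rw [h]
  show ∑ b ∈ (Finset.univ : Finset Bool), ancH b = 3
  rw [Fintype.sum_bool, ancH_twin, ancH_spine]; norm_num

/-- THE LIVE FAMILIES of the met component at step `k` [decided toy DATA]: both families at every step `k ≤ K` (= the families felt at the
cube of that scale), none above the cutoff. [folklore] -/
def ancS (K : ℕ) : ℕ → Bool → Finset Bool := fun k _ => if k ≤ K then Finset.univ else ∅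

/-- THE MET COMPONENT at step `k` [decided toy DATA]: the one cube of scale `k` (`k ≤ K`), volume `1`. [folklore] -/
def ancComp (K : ℕ) : ℕ → Bool → Finset (Fin (K + 1)) := fun k _ => if h : k ≤ K then {⟨k, Nat.lt_succ_of_le h⟩} else ∅

/-- The component's cubes have the current scale. [folklore] -/
theorem ancComp_scale (K : ℕ) : ∀ k (b : Bool), ∀ q ∈ ancComp K k b, (ancBooking K).cubeScale q = k := by
  intro k b q hq
  unfold ancComp at hq
  by_cases h : k ≤ K
  · rw [dif_pos h, Finset.mem_singleton] at hq; subst hq; rfl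
  · rw [dif_neg h] at hq; exact absurd hq (Finset.notMem_empty q)

/-- The live families are HOUSED in the component (felt at its cube — `feltAt = univ`). [folklore] -/
theorem ancS_housed (K : ℕ) : ∀ k (b : Bool), ∀ f ∈ ancS K k b, ∃ q ∈ ancComp K k b, f ∈ (ancBooking K).feltAt q := by
  intro k b f hf
  unfold ancS at hf; unfold ancComp
  by_cases h : k ≤ K
  · exact ⟨⟨k, Nat.lt_succ_of_le h⟩, by rw [dif_pos h]; exact Finset.mem_singleton_self _, Finset.mem_univ (α := Bool) f⟩
  · rw [if_neg h] at hf; exact absurd hf (Finset.notMem_empty f)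

/-- The component has volume `1`. [folklore] -/
theorem ancComp_vol (K : ℕ) : ∀ k (b : Bool), (ancComp K k b).card ≤ 1 := by
  intro k b; unfold ancComp
  by_cases h : k ≤ K
  · rw [dif_pos h, Finset.card_singleton]
  · rw [dif_neg h, Finset.card_empty]; exact Nat.zero_le _

/-- **THE BUNDLE's COUNT FIELDS FROM S49** [decided]: `hS ∧ hcountH` for the live families `ancS` supplied by S49's
`bookingCountH_of_anchoring` ONCE BY NAME — component = the cube of the current scale (`v = 1`), housing by `feltAt = univ`, the weighted
multiplicity `1·3 ≤ U.N₀`, `U.Λ = 2 = L^d` (FIRST applier of S49 §3). [folklore] -/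
theorem countFields_anc (K : ℕ) :
    (∀ k b, ∀ f ∈ ancS K k b, (ancBooking K).birthScale f ≤ k) ∧
      ∀ k b, ∀ j ≤ k, ∑ f ∈ (ancS K k b).filter (fun f => (ancBooking K).birthScale f = j), ancH f ≤
        ancConstants.N₀ * ancConstants.Λ ^ (k - j) :=
  bookingCountH_of_anchoring ancConstants (ancAnchoring K) two_pos (fun f => (ancH_pos f).le) (by norm_num : (0 : ℝ) ≤ 3)
    (weightedMult_anc K) (ancComp_scale K) (ancS_housed K) (ancComp_vol K)
    (by show ((1 : ℕ) : ℝ) * 3 ≤ 3; norm_num) (by show (2 : ℝ) = ((2 : ℕ) : ℝ) ^ 1; norm_num)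

/-- **THE FAMILY LEAVES OF THE ANCHORED TOWER** [decided]: the family-format binders with `ancConstants` — `C ≡ 1`, the NON-constant weights
`ancH`, W56's family rates `famRate`, no regeneration, door-2 classes `σ b k = ancH b·(A₀ρ₁^k τ^K)` EXACTLY, margins `0`, live families
`ancS`; `hS`∕`hcountH` ARE `countFields_anc` (S49); births∕transport∕regeneration hold outright. [folklore] -/
def ancLeaves (K : ℕ) : BookingLeavesFam ancConstants (ancBooking K) (ancTrajectory K) where
  C := fun _ => 1
  H := ancH
  ρ := fun b _ => famRate b
  c := fun _ _ => 0
  σ := fun b k => ancH b * ((1 : ℝ) * (1 / 4 : ℝ) ^ k * (1 / 2 : ℝ) ^ K)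
  s₀ := fun _ _ => 0
  S := ancS K
  hC := fun _ => zero_le_one
  hρ := fun b _ => famRate_nonneg b
  hc := fun _ _ => le_rfl
  hrate := fun b k _ _ => by
    show (famRate b + 1 * 0) * (ancH b * (1 * (1 / 4 : ℝ) ^ k * (1 / 2 : ℝ) ^ K)) ≤
      ancH b * (1 * (1 / 4 : ℝ) ^ (k + 1) * (1 / 2 : ℝ) ^ K)
    have hX : 0 ≤ ancH b * (1 * (1 / 4 : ℝ) ^ k * (1 / 2 : ℝ) ^ K) := mul_nonneg (ancH_pos b).le (by positivity)
    calc (famRate b + 1 * 0) * (ancH b * (1 * (1 / 4 : ℝ) ^ k * (1 / 2 : ℝ) ^ K))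
        = famRate b * (ancH b * (1 * (1 / 4 : ℝ) ^ k * (1 / 2 : ℝ) ^ K)) := by ring
      _ ≤ (1 / 4 : ℝ) * (ancH b * (1 * (1 / 4 : ℝ) ^ k * (1 / 2 : ℝ) ^ K)) := mul_le_mul_of_nonneg_right (famRate_le b) hX
      _ = ancH b * (1 * (1 / 4 : ℝ) ^ (k + 1) * (1 / 2 : ℝ) ^ K) := by ring
  hσ := fun f k _ _ => by
    show ancH f * (1 * (1 / 4 : ℝ) ^ k * (1 / 2 : ℝ) ^ K) ≤
      ancH f * (ancConstants.A₀ * ancConstants.ρ₁ ^ (k - 0) * ancConstants.τ ^ (K - 0))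
    exact le_of_eq rfl
  hS := (countFields_anc K).1
  hcountH := (countFields_anc K).2
  hs₀ := fun _ _ => by
    show (0 : ℝ) ≤ 1 / 2
    norm_num
  hbirth := fun b _ _ _ => by
    show (1 : ℝ) * (if (0 : ℕ) = 0 then ancH b * (1 / 2 : ℝ) ^ K else 0) ≤ ancH b * (1 * (1 / 4 : ℝ) ^ (0 : ℕ) * (1 / 2 : ℝ) ^ K)
    simp
  htr := fun b k' k _ _ _ _ => by
    show (if k' = 0 then ancH b * famRate b ^ k * (1 / 2 : ℝ) ^ K else 0) ≤
      1 * stepProd (fun _ => famRate b) k' k * (if k' = 0 then ancH b * (1 / 2 : ℝ) ^ K else 0)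
    by_cases h : k' = 0
    · subst h
      rw [if_pos rfl, if_pos rfl, stepProd_const, Nat.sub_zero]
      exact le_of_eq (by ring)
    · simp [h]
  hreg := fun b k _ _ _ => by
    show (if k + 1 = 0 then ancH b * (1 / 2 : ℝ) ^ K else 0) ≤ 0 * ((ancBooking K).size b k)
    simp

/-- **ROOT-B OF THE ANCHORED TOWER THROUGH S49's ANCHORED END** [decided]: for every weight profile `0 ≤ w ≤ w̄`, `DressedBudget ancTower w` —
S49's `dressedBudget_of_familyLeaves_anchored` ONCE BY NAME (FIRST applier): ONE `U`, the family leaves, the anchorings `ancAnchoring K`, ONE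
weighted multiplicity `mH = 3 ≤ U.N₀`, `U.Λ = L^d`; END-B-fam's cube-side count `hcountHq` is no longer a displayed binder. [folklore] -/
theorem dressedBudget_ancTower {w : Unit → ℕ → ℕ → ℝ} {wbar : ℝ} (hwbar : 0 ≤ wbar)
    (hw0 : ∀ p K, ∀ j ≤ K, 0 ≤ w p K j) (hwb : ∀ p K, ∀ j ≤ K, w p K j ≤ wbar) : DressedBudget ancTower w :=
  dressedBudget_of_familyLeaves_anchored ancConstants ancTower (fun _ K => ancLeaves K) (fun _ K => ancAnchoring K) two_pos
    (fun _ _ f => (ancH_pos f).le) (fun _ K => weightedMult_anc K) (by show (3 : ℝ) ≤ 3; norm_num)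
    (by show (2 : ℝ) = ((2 : ℕ) : ℝ) ^ 1; norm_num) hwbar hw0 hwb

/-- The weights of the anchored tower ARE non-constant (`(ancLeaves K).H true = 2 ≠ 1 = (ancLeaves K).H false`). [folklore] -/
theorem ancLeaves_H_nonconstant (K : ℕ) : (ancLeaves K).H true ≠ (ancLeaves K).H false := by
  show ancH true ≠ ancH false
  rw [ancH_twin, ancH_spine]; norm_num

/-! ## §2 NEGATIVE: W56's `famTower` passes END-B-fam's count K-freely but admits NO K-free weighted anchoring multiplicity -/

/-- **THE HEAVY FAMILY's ANCHOR BLOCK CARRIES ITS WEIGHT** [decided]: for ANY anchoring `A` of W56's `famBooking K` (any dimension, any blocking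
factor) there is a scale-`0` block `x` (in the heavy family's domain — the heavy family IS felt at the top cube, so `felt_under` provides one)
whose weighted multiplicity is `≥ 3^K`. [folklore] -/
theorem famBooking_weightedMult_ge (K : ℕ) {d L : ℕ} (A : Anchoring (famBooking K) d L) :
    ∃ x : Fin d → ℕ, (3 : ℝ) ^ K ≤
      ∑ b ∈ (famBooking K).births.filter (fun b => (famBooking K).birthScale b = 0 ∧ x ∈ A.dom b), famH K b := by
  -- the heavy family is felt at the top cube
  have hfelt : true ∈ (famBooking K).feltAt ⟨K, Nat.lt_succ_self K⟩ := by
    show true ∈ (if (⟨K, Nat.lt_succ_self K⟩ : Fin (K + 1)).val = K then (Finset.univ : Finset Bool) else {false})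
    rw [if_pos rfl]; exact Finset.mem_univ true
  obtain ⟨x, hx, -⟩ := A.felt_under _ true hfelt
  refine ⟨x, ?_⟩
  have hmem : true ∈ (famBooking K).births.filter (fun b => (famBooking K).birthScale b = 0 ∧ x ∈ A.dom b) :=
    Finset.mem_filter.2 ⟨Finset.mem_univ (α := Bool) true, rfl, hx⟩
  calc (3 : ℝ) ^ K = famH K true := (famH_heavy K).symm
    _ ≤ ∑ b ∈ (famBooking K).births.filter (fun b => (famBooking K).birthScale b = 0 ∧ x ∈ A.dom b), famH K b :=
        Finset.single_le_sum (fun b _ => (famH_pos K b).le) hmem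

/-- **NO K-FREE WEIGHTED ANCHORING MULTIPLICITY ON W56's TOWER** [decided]: there is no `mH` such that at every cutoff SOME anchoring of
`famBooking K` (any `d`, any `L`) has weighted multiplicity `≤ mH` at every scale and block — S49's anchoring-layer binder `hmult` is
uninhabitable K-freely there, although END-B-fam's cube-side count `hcountHq` holds with `N₀ = 2`, `Λ = 3` (W56 `hcountHq_fam`). [folklore] -/
theorem famBooking_no_kfree_weightedMult :
    ¬ ∃ mH : ℝ, ∀ K : ℕ, ∃ (d L : ℕ) (A : Anchoring (famBooking K) d L), ∀ (j : ℕ) (x : Fin d → ℕ),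
      ∑ b ∈ (famBooking K).births.filter (fun b => (famBooking K).birthScale b = j ∧ x ∈ A.dom b), famH K b ≤ mH := by
  rintro ⟨mH, h⟩
  obtain ⟨K, hK⟩ := famH_unbounded mH
  obtain ⟨d, L, A, hA⟩ := h K
  obtain ⟨x, hx⟩ := famBooking_weightedMult_ge K A
  have h1 := hA 0 x
  rw [famH_heavy] at hK
  linarith

/-- **THE ANCHORING LAYER IS STRICTLY STRONGER THAN END-B-fam's COUNT** [decided]: W56's tower satisfies END-B-fam's cube-side weighted count
with ONE `(N₀, Λ) = (2, 3)` at every cutoff, yet admits no K-free weighted anchoring multiplicity — S49's relocation of the history price from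
the count to the anchor block is LOSSY for weights growing with the cutoff (the positional-room mechanism of W56 is not captured). [folklore] -/
theorem anchoringLayer_strictly_stronger :
    (∀ K (q : (famBooking K).Cube) (j : ℕ), j ≤ (famBooking K).cubeScale q →
        ∑ b ∈ (famBooking K).feltOfScale q j, famH K b ≤ famConstants.N₀ * famConstants.Λ ^ ((famBooking K).cubeScale q - j)) ∧
      ¬ ∃ mH : ℝ, ∀ K : ℕ, ∃ (d L : ℕ) (A : Anchoring (famBooking K) d L), ∀ (j : ℕ) (x : Fin d → ℕ),
        ∑ b ∈ (famBooking K).births.filter (fun b => (famBooking K).birthScale b = j ∧ x ∈ A.dom b), famH K b ≤ mH :=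
  ⟨fun K => hcountHq_fam K, famBooking_no_kfree_weightedMult⟩

/-- … while the anchored toy of §1 has BOTH (its multiplicity `3` is K-free): the two mechanisms separate exactly on K-growing weights.
[folklore] -/
theorem ancBooking_kfree_weightedMult :
    ∃ mH : ℝ, ∀ K : ℕ, ∃ (d L : ℕ) (A : Anchoring (ancBooking K) d L), ∀ (j : ℕ) (x : Fin d → ℕ),
      ∑ b ∈ (ancBooking K).births.filter (fun b => (ancBooking K).birthScale b = j ∧ x ∈ A.dom b), ancH b ≤ mH :=
  ⟨3, fun K => ⟨1, 2, ancAnchoring K, weightedMult_anc K⟩⟩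

end Summit.QuantumFields.BalabanUV.T4Continuum.NE1p.DressedFamilyAnchoringWitness

end
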